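import Summits.QuantumFields.YangMills.Theorems.BalabanUVNodesN15TwoSpacingGluingNeumannKnit
import Summits.QuantumFields.YangMills.Theorems.BalabanUVNodesN15BumpCoverLift
import Summits.QuantumFields.YangMills.Theorems.BalabanUVNodesN15NeumannCubeTailRow
import HarnessLib

/-!
# THE GLUING STEP AT TWO LATTICE SPACINGS — (Γ15) THE LIVE-`U` KNIT AT THE COVER, I: THE COVER-SIDE ROWS OF THE DRESSED SMOOTH-CUT CUBE DEVICE IN dag-n15-w3's CURRENCY
# (`fgrad`∕`bgrad` along `bshiftEquiv`, scalar carrier `Tor (fine n M) × Fin (d+1)`): the partition inside the cut, the bump's plateau on an inner box and the TAIL GAP `≥ w`,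
# the cube rows `M_{χ_□}∇_μG(□)`, `M_{χ_□}∇⁻_μG(□)`, the plateau identity `G(□)∘M_{χ_□} = G(□)`, the exact locality `M_{h}(Σ∇*∇ + N_L)G(□) = M_h`, and the tail row
# `(−M_{h_k}∘N_L∘M_{1−χ̃_k})∘G(□_k) ≤ 1_□1_□·c_T e^{−δ_g w}·e^{−δ_T d}` (dag-n15-c g15, FILE 117; N15 = NE2, s1 «background-layer OPERATOR ingredient»)

Cell `pub-ymgap`, seat `pub-ymgap-dag-n15-c` (R134 (a); HUMAN RULING D-0062), generation 15.  `bears_on: R4∕N15 · K3⁸ SpineGivenEndpointR13SepCoPHV (stmt-QuantumFields-27366)`.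
Filed `--kind proof --supports stmt-QuantumFields-27366 --as helper` — COUNT-NEUTRAL.  Theorems only; 0 `def`, 0 `sorry`.  Imports BY NAME FILE 70 `…NeumannKnit` (through it FILES 43–69:
`coverXi`, `coverCorner`, `hcube` partition letters, `margin_le_tdistT_side`, `val_blockOf_sub_of_hcube_ne_zero`, `mem_intBonds_of_hcube_ne_zero`, `deltaOp_eq_lapOp_zero_add`; dag-n15-a
PROGRAMME N: `neumannCubeG`, `neumannCubeG_eq_chiCube`, `mulOp_comp_deltaOp_comp_neumannCubeG`, `hasMaj_chiCube_grad_neumannCubeG_of`, `hasMaj_chiCube_divAdjOut_neumannCubeG_of`,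
`symbOp_sD_eq`, `bgrad_eq_neg_symbOp`), dag-n15-w4 `…BumpCoverLift` (`bcube`, `bcube_eq_one_of_forall_abs_cenRep_le`, `chi_eq_one_of_hcube_ne_zero`, `mulOp_comp_mulOp_of_support_left`) and
dag-n15-a N-IIt `…NeumannCubeTailRow` (`hasMaj_tail_neumannCubeG`).  Nothing in the tree is modified, no landed name re-declared.

WHY.  The (r3) road of the node (dag-lead DEDUP-400∕401; dag-n15-w3 g5 ■ I.40642 «(c) the INSTANTIATED live-U knit = 52∕53 at the neumannCubeG family + n15-c's cover — n15-c's lane»):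
dag-n15-w3's `U(m)` capstones `uN_hasMaj_glueInv_smoothCutDressed_localGauges` ∕ `…_inverse` (p644977) display, per cube `k`, the cube rows `hcut hcutF hcutB`, the plateau `hNψ`, the exact
locality `hloc0`, the tail `hT`, the partition rows `hhcut hχh hhs' hhsb' hhdd' hhddb'` and the bump rows (the latter = dag-n15-w4 V–VII BY NAME).  THIS FILE types the remaining ones ON THE
SCALAR CARRIER at FILE 66's cover (doubled torus `M_ν = 2qw`, cube `□_k` of side `S` with corner `c(k) = coverCorner M w q m₀ k`, partition `h_k = hcube (2q) ξ k`, bump `χ̃_k = bcube (2q) ξ 2 k`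
— radius `R = 2` — and cut `χ_k = χ_{□_k}` the indicator of the cube's blocks); FILE 118 lifts them `⊗ 1_ι` and calls 52.
* §1 (generic carrier) the partition inside a cut that is `1` on the radius-`3` neighbourhood: `cut_hcube`, `cut_hcube_comp_shift`, `cut_hcube_comp_shift_symm`, `cut_fgrad_hcube`, `cut_bgrad_hcube`.
* §2 ★★ `bcube_cover_eq_one_of_mem_innerBox` — the radius-2 bump is `≡ 1` on every block of the INNER BOX `coverCorner M w q (w−1) k + [0, 4w−1)^{d+1}`; ★★ `coverGap_le_tdistT` — a block meeting
  `supp h_k` and a block outside the inner box are `≥ w` apart (FILE 72 `margin_le_tdistT_side` at margin `w − 1`).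
* §3 the cube rows in `fgrad`∕`bgrad` currency: ★ `hasMaj_chiCube_fgrad_neumannCubeG` ∕ ★ `hasMaj_chiCube_bgrad_neumannCubeG` (any weight `c = n`), `mulOp_chiCube_idem`, ★ `neumannCubeG_comp_mulOp_chiCube`
  (`hNψ`), ★ `mulOp_coverH_comp_lapOp_add_comp_neumannCubeG` (`hloc0`: N-IIIa + FILE 69's split `Δ_a = (Σ∇*∇ + 0) + (aQ*Q − ∂Π∂*)`).
* §4 ★★★ `hasMaj_tail_cover` — `hT` at the cover: n15-a `hasMaj_tail_neumannCubeG` with `H` = the blocks meeting `supp h_k`, `A` = the inner box, `gap = w`.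

HONEST FRAMING ∕ LIMITS.  Lattice geometry + block-majorant bookkeeping over LANDED rows; no new analytic estimate; `U ≡ 1` doubled-cube torus MODEL cubes (the live `U` enters only in FILE 118
through dag-n15-w3's dressed cubes); nothing of [B5]∕[B6]∕[B9] asserted ((2.36)–(2.37) p.229, (2.91)–(2.93) p.239, (2.133)–(2.136) p.247, (3.62)–(3.65) pp.402–403 = SHAPES ∕ MECHANISM).
NE2⁺ NOT PRINTED, NOT proved; N15 NOT discharged; K3⁸ OPEN, skeleton v6 untouched; counts of record UNMOVED (typed 28∕28 · discharged 5∕27); one finite 𝕋⁴ at fixed ε — NOT infinite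
volume, NOT OS on ℝ⁴, NOT a mass gap, NOT Clay; R4 closes the conditional finite-𝕋⁴ rung `BalabanLadder.UV` only.  Restate-immune (no Theses import).
-/

noncomputable section

namespace Summit.QuantumFields.YangMills.BalabanUVNodes.N15.Gluing

open Real
open Literature.MathematicalPhysics.QuantumFieldTheory.Balaban1983to89
open Literature.MathematicalPhysics.QuantumFieldTheory.Balaban1983to89.B5Prop11Plancherel (Tor fine unitVec)
open Literature.MathematicalPhysics.QuantumFieldTheory.Balaban1983to89.B5Block118 (up)
open Literature.MathematicalPhysics.QuantumFieldTheory.Balaban1983to89.B11SectG (BlockNorm HasMaj RowSum)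
open Literature.MathematicalPhysics.QuantumFieldTheory.Balaban1983to89.B6RandomWalk (Triangle254)
open Literature.MathematicalPhysics.QuantumFieldTheory.Balaban1983to89.B6Prop26Gluing (mulOp mulOp_apply ind ind_nonneg ind_le_one)
open Literature.MathematicalPhysics.QuantumFieldTheory.Balaban1983to89.B6UnitTorusCarrier (unitTorusGeo)
open Literature.MathematicalPhysics.QuantumFieldTheory.King1986.Torus (blockOf val_blockOf tdistT tdistT_nonneg tdistT_symm)
open Summit.QuantumFields.YangMills.BalabanUVNodes.N15.BackgroundLayer (fgrad fgradAdj bgrad fgrad_apply bgrad_apply symbOp_sD_eq)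
open Summit.QuantumFields.YangMills.BalabanUVNodes.N15.VectorPiece (bshiftEquiv bshiftEquiv_apply bshiftEquiv_symm_apply)
open Summit.QuantumFields.YangMills.BalabanUVNodes.N15.TwoGrid (symbOp sT sTinv sD deltaOp landauRe qvRe qvAdjRe gOp symOp neumannCubeG chiCube cubeBlocks mem_cubeBlocks
  blockOf_sub_up neumannCubeG_eq_chiCube mulOp_comp_deltaOp_comp_neumannCubeG hasMaj_chiCube_grad_neumannCubeG_of hasMaj_chiCube_divAdjOut_neumannCubeG_of hasMaj_tail_neumannCubeG
  hasMaj_chiCube_symOp_comp hasMaj_comp_mulOp_chiInt hasMaj_mulOp_comp_of_abs_le_one abs_chiCube_le_one)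

variable {d : ℕ}

/-! ## §1 The partition inside a cut which is `1` on the radius-`R + 1` neighbourhood of the cell (generic carrier) -/

section Cut

variable {X : Type} {J : Type} [Fintype J] (K : ℕ) (ξ : J → X → ℝ) (R : ℝ) (e : J → X ≃ X) (μ : J) {χ : X → ℝ} {k : J → ZMod K}

omit [Fintype J] in
/-- the radius-`R + 1` window of the bump (dag-n15-w4's cut hypothesis) implies FILE 62's radius-`1` window of the partition (`R ≥ 0`). [folklore] -/
theorem hcubeWindow_of_bumpWindow (hR : 0 ≤ R)
    (hχ : ∀ x : X, (∃ x₀ : X, (x₀ = x ∨ x₀ = e μ x ∨ x₀ = (e μ).symm x) ∧ ∀ ν, |cenRep K (ξ ν x₀ - ((k ν).val : ℝ))| < R + 1) → χ x = 1) :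
    ∀ x : X, (∃ x₀ : X, (x₀ = x ∨ x₀ = e μ x ∨ x₀ = (e μ).symm x) ∧ ∀ ν, |cenRep K (ξ ν x₀ - ((k ν).val : ℝ))| < 1) → χ x = 1 :=
  fun x ⟨x₀, h0, hc⟩ => hχ x ⟨x₀, h0, fun ν => (hc ν).trans_le (by linarith)⟩

/-- ★ `M_χ∘M_{h_k} = M_{h_k}` (52's `hχh`). [cite: Balaban1984PropagatorsII, (2.36)–(2.37) p.229 (supp h_□ ⊂ □: shape)] -/
theorem cut_hcube (hR : 0 ≤ R)
    (hχ : ∀ x : X, (∃ x₀ : X, (x₀ = x ∨ x₀ = e μ x ∨ x₀ = (e μ).symm x) ∧ ∀ ν, |cenRep K (ξ ν x₀ - ((k ν).val : ℝ))| < R + 1) → χ x = 1) :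
    mulOp χ ∘ₗ mulOp (hcube K ξ k) = mulOp (hcube K ξ k) :=
  mulOp_comp_mulOp_of_support_left fun _ hx => chi_eq_one_of_hcube_ne_zero K ξ e μ (hcubeWindow_of_bumpWindow K ξ R e μ hR hχ) (Or.inl rfl) hx

/-- ★ `M_χ∘M_{h_k∘e_μ} = M_{h_k∘e_μ}` (52's `hhs'`). [folklore] -/
theorem cut_hcube_comp_shift (hR : 0 ≤ R)
    (hχ : ∀ x : X, (∃ x₀ : X, (x₀ = x ∨ x₀ = e μ x ∨ x₀ = (e μ).symm x) ∧ ∀ ν, |cenRep K (ξ ν x₀ - ((k ν).val : ℝ))| < R + 1) → χ x = 1) :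
    mulOp χ ∘ₗ mulOp (hcube K ξ k ∘ e μ) = mulOp (hcube K ξ k ∘ e μ) :=
  mulOp_comp_mulOp_of_support_left fun _ hx => chi_eq_one_of_hcube_ne_zero K ξ e μ (hcubeWindow_of_bumpWindow K ξ R e μ hR hχ) (Or.inr (Or.inl rfl)) hx

/-- ★ `M_χ∘M_{h_k∘e_μ⁻¹} = M_{h_k∘e_μ⁻¹}` (52's `hhsb'`). [folklore] -/
theorem cut_hcube_comp_shift_symm (hR : 0 ≤ R)
    (hχ : ∀ x : X, (∃ x₀ : X, (x₀ = x ∨ x₀ = e μ x ∨ x₀ = (e μ).symm x) ∧ ∀ ν, |cenRep K (ξ ν x₀ - ((k ν).val : ℝ))| < R + 1) → χ x = 1) :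
    mulOp χ ∘ₗ mulOp (hcube K ξ k ∘ (e μ).symm) = mulOp (hcube K ξ k ∘ (e μ).symm) :=
  mulOp_comp_mulOp_of_support_left fun _ hx => chi_eq_one_of_hcube_ne_zero K ξ e μ (hcubeWindow_of_bumpWindow K ξ R e μ hR hχ) (Or.inr (Or.inr rfl)) hx

/-- ★ `M_χ∘M_{∇_μh_k} = M_{∇_μh_k}` (52's `hhdd'`), any weight `c`. [folklore] -/
theorem cut_fgrad_hcube (hR : 0 ≤ R) (c : ℝ)
    (hχ : ∀ x : X, (∃ x₀ : X, (x₀ = x ∨ x₀ = e μ x ∨ x₀ = (e μ).symm x) ∧ ∀ ν, |cenRep K (ξ ν x₀ - ((k ν).val : ℝ))| < R + 1) → χ x = 1) :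
    mulOp χ ∘ₗ mulOp (fgrad c (e μ) (hcube K ξ k)) = mulOp (fgrad c (e μ) (hcube K ξ k)) := by
  have hχ' := hcubeWindow_of_bumpWindow K ξ R e μ hR hχ
  refine mulOp_comp_mulOp_of_support_left fun x hx => ?_
  rw [fgrad_apply] at hx
  by_cases h1 : hcube K ξ k (e μ x) = 0
  · by_cases h0 : hcube K ξ k x = 0
    · exact absurd (by rw [h1, h0]; ring) hx
    · exact chi_eq_one_of_hcube_ne_zero K ξ e μ hχ' (Or.inl rfl) h0
  · exact chi_eq_one_of_hcube_ne_zero K ξ e μ hχ' (Or.inr (Or.inl rfl)) h1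

/-- ★ `M_χ∘M_{∇⁻_μh_k} = M_{∇⁻_μh_k}` (52's `hhddb'`), any weight `c`. [folklore] -/
theorem cut_bgrad_hcube (hR : 0 ≤ R) (c : ℝ)
    (hχ : ∀ x : X, (∃ x₀ : X, (x₀ = x ∨ x₀ = e μ x ∨ x₀ = (e μ).symm x) ∧ ∀ ν, |cenRep K (ξ ν x₀ - ((k ν).val : ℝ))| < R + 1) → χ x = 1) :
    mulOp χ ∘ₗ mulOp (bgrad c (e μ) (hcube K ξ k)) = mulOp (bgrad c (e μ) (hcube K ξ k)) := by
  have hχ' := hcubeWindow_of_bumpWindow K ξ R e μ hR hχ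
  refine mulOp_comp_mulOp_of_support_left fun x hx => ?_
  rw [bgrad_apply] at hx
  by_cases h1 : hcube K ξ k ((e μ).symm x) = 0
  · by_cases h0 : hcube K ξ k x = 0
    · exact absurd (by rw [h1, h0]; ring) hx
    · exact chi_eq_one_of_hcube_ne_zero K ξ e μ hχ' (Or.inl rfl) h0
  · exact chi_eq_one_of_hcube_ne_zero K ξ e μ hχ' (Or.inr (Or.inr rfl)) h1

end Cut

/-! ## §2 The plateau of the radius-2 bump on the inner box, and the tail gap `≥ w` -/

section Plateau

variable {M : Fin (d + 1) → ℕ} [∀ μ, NeZero (M μ)] {n w q : ℕ} [NeZero n]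

/-- ★★ **THE INNER BOX LIES IN THE PLATEAU OF THE RADIUS-2 BUMP**: every point whose block lies in `c′(k) + [0, 4w − 1)^{d+1}`, `c′(k) = coverCorner M w q (w − 1) k = w·k − 2w + 1`, has
`|v_{2q}(ξ_ν − k_ν)| ≤ 2` in every direction, hence `χ̃_k = bcube (2q) ξ 2 k = 1` there (torus `M_ν = 2qw`). [cite: Balaban1985BackgroundPropagators, (3.62)–(3.65) pp.402–403 (the plateau of the cut-off: shape)] -/
theorem bcube_cover_eq_one_of_mem_innerBox (hM : ∀ ν, M ν = 2 * q * w) (hw : 0 < w) {k : Fin (d + 1) → ZMod (2 * q)} {x : Tor (fine n M) × Fin (d + 1)}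
    (hx : blockOf n M x.1 ∈ cubeBlocks M (coverCorner M w q (w - 1) k) (4 * w - 1)) : bcube (2 * q) (coverXi M n w) 2 k x = 1 := by
  have hn : 0 < n := Nat.pos_of_ne_zero (NeZero.ne n)
  have hnr : (0 : ℝ) < n := by exact_mod_cast hn
  have hwr : (0 : ℝ) < w := by exact_mod_cast hw
  have hnw : (0 : ℝ) < (n : ℝ) * w := by positivity
  have hq : 0 < 2 * q := by
    rcases Nat.eq_zero_or_pos q with h | h
    · subst h; exact absurd (hM 0) (by have := NeZero.ne (M 0); simpa using this)
    · omega
  rw [blockOf_mem_cubeBlocks_iff] at hx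
  refine bcube_eq_one_of_forall_abs_cenRep_le (2 * q) (coverXi M n w) 2 fun ν => ?_
  have hN : fine n M ν = n * (2 * q * w) := by show n * M ν = _; rw [hM ν]
  haveI : NeZero (fine n M ν) := ⟨by rw [hN]; positivity⟩
  have hlt := hx ν
  -- the relative coordinate as the cast of one integer
  set t : ℕ := (x.1 ν).val with ht
  set kv : ℕ := (k ν).val with hkv
  set V : ℤ := (t : ℤ) - (n : ℤ) * ((w : ℤ) * (kv : ℤ) - w - ((w - 1 : ℕ) : ℤ)) with hV
  have hcast : (x.1 - up n M (coverCorner M w q (w - 1) k)) ν = ((V : ℤ) : ZMod (fine n M ν)) := by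
    rw [Pi.sub_apply, sub_up_coverCorner_eq, hV]
  have hval : ((((x.1 - up n M (coverCorner M w q (w - 1) k)) ν).val : ℤ)) = V % (fine n M ν : ℕ) := by rw [hcast, ZMod.val_intCast]
  set v : ℕ := ((x.1 - up n M (coverCorner M w q (w - 1) k)) ν).val with hv
  -- `t = n(w·kv − 2w + 1) + v + N·z`
  set z : ℤ := V / (fine n M ν : ℕ) with hz
  have hdecomp : (t : ℤ) = (n : ℤ) * ((w : ℤ) * kv - w - ((w - 1 : ℕ) : ℤ)) + (v : ℤ) + ((fine n M ν : ℕ) : ℤ) * z := by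
    have h1 : (v : ℤ) = V - ((fine n M ν : ℕ) : ℤ) * z := by rw [hval, hz, Int.emod_def]
    rw [h1, hV]; ring
  have hw1 : ((w - 1 : ℕ) : ℝ) = (w : ℝ) - 1 := by rw [Nat.cast_sub (by omega)]; simp
  have hvlt : (v : ℝ) < (4 * (w : ℝ) - 1) * n := by
    have : ((v : ℕ) : ℝ) < (((4 * w - 1) * n : ℕ) : ℝ) := by exact_mod_cast hlt
    rw [Nat.cast_mul, Nat.cast_sub (by omega)] at this
    simpa using this
  have hv0 : (0 : ℝ) ≤ v := Nat.cast_nonneg _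
  -- the `ξ`-coordinate relative to the cell centre
  have hξ : coverXi M n w ν x - (kv : ℝ) = (-2 + 1 / (w : ℝ) + (v : ℝ) / ((n : ℝ) * w)) + (z : ℝ) * ((2 * q : ℕ) : ℝ) := by
    unfold coverXi
    rw [← ht]
    have htR : (t : ℝ) = (n : ℝ) * ((w : ℝ) * kv - w - ((w : ℝ) - 1)) + (v : ℝ) + (n : ℝ) * (2 * q * w) * z := by
      have h1 : ((t : ℤ) : ℝ) = (((n : ℤ) * ((w : ℤ) * kv - w - ((w - 1 : ℕ) : ℤ)) + (v : ℤ) + ((fine n M ν : ℕ) : ℤ) * z : ℤ) : ℝ) := by rw [hdecomp]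
      push_cast at h1
      rw [hM ν] at h1
      push_cast at h1
      rw [hw1] at h1
      linarith
    rw [htR]
    push_cast
    field_simp
    ring
  rw [hξ, cenRep_add_int_mul hq]
  refine (abs_cenRep_le_abs_sub hq _ 0).trans ?_
  rw [Int.cast_zero, zero_mul, sub_zero, abs_le]
  constructor
  · have : 0 ≤ 1 / (w : ℝ) := by positivity
    have : 0 ≤ (v : ℝ) / ((n : ℝ) * w) := by positivity
    linarith
  · have h1 : (v : ℝ) / ((n : ℝ) * w) ≤ (4 * (w : ℝ) - 1) / w := by
      rw [div_le_div_iff₀ hnw hwr]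
      nlinarith
    have h2 : (4 * (w : ℝ) - 1) / w = 4 - 1 / w := by field_simp
    linarith

/-- ★★ **THE TAIL GAP**: a block meeting `supp h_k` and a block OUTSIDE the inner box `c′(k) + [0, 4w − 1)^{d+1}` are `≥ w` apart on the torus (`M_ν = 2qw`, `q ≥ 2`) — FILE 72
`margin_le_tdistT_side` at margin `w − 1` for the inner box, whose window `[w − 1, 3w − 1)` holds the blocks of `supp h_k` (FILE 66 `val_blockOf_sub_of_hcube_ne_zero`).
[cite: Balaban1984PropagatorsII, p.239 («ζ_□ … distance ⅓M to the boundary of □»: shape); Balaban1985BackgroundPropagators, (3.63)–(3.65) pp.402–403] -/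
theorem coverGap_le_tdistT (hM : ∀ ν, M ν = 2 * q * w) (hw : 0 < w) (hq : 2 ≤ q) {k : Fin (d + 1) → ZMod (2 * q)} {x : Tor (fine n M) × Fin (d + 1)} {y' : Tor M}
    (hx : hcube (2 * q) (coverXi M n w) k x ≠ 0) (hx' : y' ∉ cubeBlocks M (coverCorner M w q (w - 1) k) (4 * w - 1)) :
    (w : ℝ) ≤ tdistT M (blockOf n M x.1) y' := by
  have h4 : 4 * w ≤ 2 * q * w := by nlinarith [hq]
  have hwin := fun ν => val_blockOf_sub_of_hcube_ne_zero (m₀ := w - 1) hM hw (by omega) hx ν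
  have h := margin_le_tdistT_side (m₀ := w - 1) (S := 4 * w - 1) hM (by omega) (by omega) hx' (fun ν => ⟨(hwin ν).1, by have := (hwin ν).2; omega⟩)
  rw [tdistT_symm, Nat.cast_sub (by omega), Nat.cast_one, sub_add_cancel] at h
  exact h

end Plateau



/-! ## §2b Nested boxes about one cell: the inner cut box `c(m₁, k) + [0, S₁)^{d+1}` inside the cube `c(m₀, k) + [0, S₀)^{d+1}` -/

section Nested

variable {M : Fin (d + 1) → ℕ} [∀ μ, NeZero (M μ)] {n w q m₀ m₁ S₀ S₁ : ℕ} [NeZero n]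

omit [∀ μ, NeZero (M μ)] in
/-- relative coordinates about the two corners differ by the constant `m₀ − m₁`: `(y − c(m₀,k))_ν = (y − c(m₁,k))_ν + (m₀ − m₁)` (`m₁ ≤ m₀`). [folklore] -/
theorem sub_coverCorner_eq_add (hm : m₁ ≤ m₀) (k : Fin (d + 1) → ZMod (2 * q)) (y : Tor M) (ν : Fin (d + 1)) :
    (y - coverCorner M w q m₀ k) ν = (y - coverCorner M w q m₁ k) ν + ((m₀ - m₁ : ℕ) : ZMod (M ν)) := by
  simp only [Pi.sub_apply, coverCorner]
  rw [Nat.cast_sub hm]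
  push_cast
  ring

/-- ★ **NESTED BOXES**: `c(m₁,k) + [0, S₁)^{d+1} ⊆ c(m₀,k) + [0, S₀)^{d+1}` whenever `m₁ ≤ m₀` and `(m₀ − m₁) + S₁ ≤ S₀ ≤ 2qw = M_ν`. [cite: Balaban1985BackgroundPropagators, (3.62)–(3.65) pp.402–403 (nested cut-offs inside the cube: shape)] -/
theorem mem_cubeBlocks_of_mem_inner (hM : ∀ ν, M ν = 2 * q * w) (hm : m₁ ≤ m₀) (hfit : (m₀ - m₁) + S₁ ≤ S₀) (hS₀ : S₀ ≤ 2 * q * w) {k : Fin (d + 1) → ZMod (2 * q)}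
    {y : Tor M} (hy : y ∈ cubeBlocks M (coverCorner M w q m₁ k) S₁) : y ∈ cubeBlocks M (coverCorner M w q m₀ k) S₀ := by
  rw [mem_cubeBlocks] at hy ⊢
  intro ν
  have h1 : ((y - coverCorner M w q m₁ k) ν).val < S₁ := hy ν
  show ((y - coverCorner M w q m₀ k) ν).val < S₀
  have hb : ((m₀ - m₁ : ℕ) : ZMod (M ν)).val = m₀ - m₁ := ZMod.val_natCast_of_lt (by rw [hM ν]; omega)
  rw [sub_coverCorner_eq_add hm k y ν, ZMod.val_add, hb]
  exact (Nat.mod_le _ _).trans_lt (by omega)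

/-- the inner box's indicator forces the cube's: `χ_{□₁}(x) ≠ 0 ⟹ χ_{□₀}(x) = 1`. [folklore] -/
theorem chiCube_eq_one_of_inner_ne_zero (hM : ∀ ν, M ν = 2 * q * w) (hm : m₁ ≤ m₀) (hfit : (m₀ - m₁) + S₁ ≤ S₀) (hS₀ : S₀ ≤ 2 * q * w) {k : Fin (d + 1) → ZMod (2 * q)}
    {x : Tor (fine n M) × Fin (d + 1)} (hx : chiCube M n (coverCorner M w q m₁ k) S₁ x ≠ 0) : chiCube M n (coverCorner M w q m₀ k) S₀ x = 1 := by
  unfold chiCube at hx ⊢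
  by_cases h : blockOf n M x.1 ∈ cubeBlocks M (coverCorner M w q m₁ k) S₁
  · rw [if_pos (mem_cubeBlocks_of_mem_inner hM hm hfit hS₀ h)]
  · rw [if_neg h] at hx; exact absurd rfl hx

/-- the support of the inner box's indicator lies in the cube's blocks (52's `hSχ`). [folklore] -/
theorem blockOf_mem_cubeBlocks_of_inner_ne_zero (hM : ∀ ν, M ν = 2 * q * w) (hm : m₁ ≤ m₀) (hfit : (m₀ - m₁) + S₁ ≤ S₀) (hS₀ : S₀ ≤ 2 * q * w) {k : Fin (d + 1) → ZMod (2 * q)}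
    {x : Tor (fine n M) × Fin (d + 1)} (hx : chiCube M n (coverCorner M w q m₁ k) S₁ x ≠ 0) : blockOf n M x.1 ∈ cubeBlocks M (coverCorner M w q m₀ k) S₀ := by
  unfold chiCube at hx
  by_cases h : blockOf n M x.1 ∈ cubeBlocks M (coverCorner M w q m₁ k) S₁
  · exact mem_cubeBlocks_of_mem_inner hM hm hfit hS₀ h
  · rw [if_neg h] at hx; exact absurd rfl hx

/-- ★ `M_{χ_{□₀}}∘M_{χ_{□₁}} = M_{χ_{□₁}}` (52's `hψχ` with `ψ := χ_{□₀}`, `χ := χ_{□₁}`). [folklore] -/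
theorem cut_chiCube_inner (hM : ∀ ν, M ν = 2 * q * w) (hm : m₁ ≤ m₀) (hfit : (m₀ - m₁) + S₁ ≤ S₀) (hS₀ : S₀ ≤ 2 * q * w) (k : Fin (d + 1) → ZMod (2 * q)) :
    mulOp (chiCube M n (coverCorner M w q m₀ k) S₀) ∘ₗ mulOp (chiCube M n (coverCorner M w q m₁ k) S₁) = mulOp (chiCube M n (coverCorner M w q m₁ k) S₁) :=
  mulOp_comp_mulOp_of_support_left fun _ hx => chiCube_eq_one_of_inner_ne_zero hM hm hfit hS₀ hx

/-- ★ `M_{χ_{□₁}}∘M_{χ_{□₀}} = M_{χ_{□₁}}`. [folklore] -/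
theorem chiCube_inner_cut (hM : ∀ ν, M ν = 2 * q * w) (hm : m₁ ≤ m₀) (hfit : (m₀ - m₁) + S₁ ≤ S₀) (hS₀ : S₀ ≤ 2 * q * w) (k : Fin (d + 1) → ZMod (2 * q)) :
    mulOp (chiCube M n (coverCorner M w q m₁ k) S₁) ∘ₗ mulOp (chiCube M n (coverCorner M w q m₀ k) S₀) = mulOp (chiCube M n (coverCorner M w q m₁ k) S₁) :=
  mulOp_comp_mulOp_of_support fun _ hx => chiCube_eq_one_of_inner_ne_zero hM hm hfit hS₀ hx

/-- ★★ **A CUT ROW OF THE CUBE IS A CUT ROW OF THE INNER BOX**: `M_{χ_{□₀}}∘T ≤ K` (`K ≥ 0`) ⟹ `M_{χ_{□₁}}∘T ≤ K` (52's `hcut`∕`hcutF`∕`hcutB` at the inner cut from dag-n15-a's cube rows).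
[cite: Balaban1984PropagatorsII, (2.133) p.247 (shape)] -/
theorem hasMaj_chiCube_inner_comp {L kk : ℕ} {F₁ : Type} [AddCommGroup F₁] [Module ℝ F₁] {b₁ : BlockNorm (unitTorusGeo L kk M) F₁}
    (hM : ∀ ν, M ν = 2 * q * w) (hm : m₁ ≤ m₀) (hfit : (m₀ - m₁) + S₁ ≤ S₀) (hS₀ : S₀ ≤ 2 * q * w) (k : Fin (d + 1) → ZMod (2 * q))
    {T : F₁ →ₗ[ℝ] (Tor (fine n M) × Fin (d + 1) → ℝ)} {K : Tor M → Tor M → ℝ} (hK : ∀ y y', 0 ≤ K y y')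
    (h : HasMaj b₁ (BlockNorm.ofBlocks (unitTorusGeo L kk M) (fun b : Tor (fine n M) × Fin (d + 1) => blockOf n M b.1)) (mulOp (chiCube M n (coverCorner M w q m₀ k) S₀) ∘ₗ T) K) :
    HasMaj b₁ (BlockNorm.ofBlocks (unitTorusGeo L kk M) (fun b : Tor (fine n M) × Fin (d + 1) => blockOf n M b.1)) (mulOp (chiCube M n (coverCorner M w q m₁ k) S₁) ∘ₗ T) K := by
  rw [← chiCube_inner_cut (n := n) hM hm hfit hS₀ k, LinearMap.comp_assoc]
  exact hasMaj_mulOp_comp_of_abs_le_one _ (fun x => abs_chiCube_le_one S₁ x) hK h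

end Nested

/-! ## §3 The cube rows in `fgrad`∕`bgrad` currency, the plateau identity, the exact locality -/

section CubeRows

variable {M : Fin (d + 1) → ℕ} [∀ μ, NeZero (M μ)] {L kk n : ℕ} [NeZero n] {c₀ : Tor M} {S : ℕ}

/-- ★ **THE CUT ROW `M_{χ_□}∘G(□ + c) ≤ 1_□1_□·2^{d+1}Ce^{δ₀}·e^{−δ₀d}`** from the torus letter `G ≤ Ce^{−δ₀d}` (dag-n15-a N-IIIb∕c by name; 52's `hcut`).
[cite: Balaban1984PropagatorsII, (2.37) p.229, (2.133) p.247 (shape); Balaban1984PropagatorsI, Prop. 1.2 (1.110) p.35] -/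
theorem hasMaj_chiCube_neumannCubeG_of_gOp (hM : ∀ ν, M ν = 2 * S) {a C δ₀ : ℝ} (hC : 0 ≤ C) (hδ₀ : 0 ≤ δ₀)
    (hG : HasMaj (BlockNorm.ofBlocks (unitTorusGeo L kk M) (fun b : Tor (fine n M) × Fin (d + 1) => blockOf n M b.1))
      (BlockNorm.ofBlocks (unitTorusGeo L kk M) (fun b : Tor (fine n M) × Fin (d + 1) => blockOf n M b.1)) (gOp M n a) (fun y y' => C * Real.exp (-(δ₀ * tdistT M y y')))) :
    HasMaj (BlockNorm.ofBlocks (unitTorusGeo L kk M) (fun b : Tor (fine n M) × Fin (d + 1) => blockOf n M b.1))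
      (BlockNorm.ofBlocks (unitTorusGeo L kk M) (fun b : Tor (fine n M) × Fin (d + 1) => blockOf n M b.1))
      (mulOp (chiCube M n c₀ S) ∘ₗ neumannCubeG M n c₀ S a)
      (fun y y' => ind (cubeBlocks M c₀ S : Set (Tor M)) y * ind (cubeBlocks M c₀ S : Set (Tor M)) y' * (2 ^ (d + 1) * (C * Real.exp δ₀) * Real.exp (-(δ₀ * tdistT M y y')))) :=
  hasMaj_chiCube_symOp_comp hC hδ₀ hM (hasMaj_comp_mulOp_chiInt (c := c₀) (S := S) hC hG)

/-- ★ **52's `hcutF` ON THE SCALAR CARRIER**: `M_{χ_□}∘∇_μ∘G(□ + c) ≤ 1_□1_□·2^{d+1}Ce^{2δ₀}·e^{−δ₀d}` with this lineage's forward quotient `∇_μ = fgrad c (bshiftEquiv M n μ)` at the weight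
`c = n` (dag-n15-a `hasMaj_chiCube_grad_neumannCubeG_of` + the dictionary `symbOp_sD_eq`). [cite: Balaban1984PropagatorsII, (2.133) p.247 (shape); Balaban1984PropagatorsI, Prop. 1.2 (1.110) p.35] -/
theorem hasMaj_chiCube_fgrad_neumannCubeG (hM : ∀ ν, M ν = 2 * S) {a C δ₀ : ℝ} (hC : 0 < C) (hδ₀ : 0 < δ₀) (μ : Fin (d + 1)) {c : ℝ} (hc : c = (n : ℝ))
    (hD : HasMaj (BlockNorm.ofBlocks (unitTorusGeo L kk M) (fun b : Tor (fine n M) × Fin (d + 1) => blockOf n M b.1))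
      (BlockNorm.ofBlocks (unitTorusGeo L kk M) (fun b : Tor (fine n M) × Fin (d + 1) => blockOf n M b.1))
      (symbOp M n (sD M n μ (n : ℝ)) ∘ₗ gOp M n a) (fun y y' => C * Real.exp (-(δ₀ * tdistT M y y')))) :
    HasMaj (BlockNorm.ofBlocks (unitTorusGeo L kk M) (fun b : Tor (fine n M) × Fin (d + 1) => blockOf n M b.1))
      (BlockNorm.ofBlocks (unitTorusGeo L kk M) (fun b : Tor (fine n M) × Fin (d + 1) => blockOf n M b.1))
      (mulOp (chiCube M n c₀ S) ∘ₗ (fgrad c (bshiftEquiv M n μ) ∘ₗ neumannCubeG M n c₀ S a))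
      (fun y y' => ind (cubeBlocks M c₀ S : Set (Tor M)) y * ind (cubeBlocks M c₀ S : Set (Tor M)) y' * (2 ^ (d + 1) * (C * Real.exp δ₀ * Real.exp δ₀) * Real.exp (-(δ₀ * tdistT M y y')))) := by
  subst hc
  rw [← symbOp_sD_eq]
  exact hasMaj_chiCube_grad_neumannCubeG_of hM hC hδ₀ μ hD

/-- ★ **52's `hcutB` ON THE SCALAR CARRIER**: `M_{χ_□}∘∇⁻_μ∘G(□ + c) ≤ 1_□1_□·2^{d+1}Ce^{2δ₀}·e^{−δ₀d}` with the backward quotient `∇⁻_μ = bgrad c (bshiftEquiv M n μ) = −ρ(n•(s_μ⁻¹ − 1))`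
(dag-n15-a `hasMaj_chiCube_divAdjOut_neumannCubeG_of` + FILE 69 `bgrad_eq_neg_symbOp`). [cite: Balaban1984PropagatorsII, (2.133) p.247 (shape); Balaban1984PropagatorsI, (1.3) p.18, Prop. 1.2 (1.110) p.35] -/
theorem hasMaj_chiCube_bgrad_neumannCubeG (hM : ∀ ν, M ν = 2 * S) {a C δ₀ : ℝ} (hC : 0 ≤ C) (hδ₀ : 0 ≤ δ₀) (μ : Fin (d + 1)) {c : ℝ} (hc : c = (n : ℝ))
    (hD : HasMaj (BlockNorm.ofBlocks (unitTorusGeo L kk M) (fun b : Tor (fine n M) × Fin (d + 1) => blockOf n M b.1))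
      (BlockNorm.ofBlocks (unitTorusGeo L kk M) (fun b : Tor (fine n M) × Fin (d + 1) => blockOf n M b.1))
      (symbOp M n (sD M n μ (n : ℝ)) ∘ₗ gOp M n a) (fun y y' => C * Real.exp (-(δ₀ * tdistT M y y')))) :
    HasMaj (BlockNorm.ofBlocks (unitTorusGeo L kk M) (fun b : Tor (fine n M) × Fin (d + 1) => blockOf n M b.1))
      (BlockNorm.ofBlocks (unitTorusGeo L kk M) (fun b : Tor (fine n M) × Fin (d + 1) => blockOf n M b.1))
      (mulOp (chiCube M n c₀ S) ∘ₗ (bgrad c (bshiftEquiv M n μ) ∘ₗ neumannCubeG M n c₀ S a))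
      (fun y y' => ind (cubeBlocks M c₀ S : Set (Tor M)) y * ind (cubeBlocks M c₀ S : Set (Tor M)) y' * (2 ^ (d + 1) * (C * Real.exp δ₀ * Real.exp δ₀) * Real.exp (-(δ₀ * tdistT M y y')))) := by
  subst hc
  rw [bgrad_eq_neg_symbOp, LinearMap.neg_comp, LinearMap.comp_neg]
  exact (hasMaj_chiCube_divAdjOut_neumannCubeG_of hM hC hδ₀ μ hD).neg

/-- the indicator of the cube's blocks takes the value `1` wherever it is nonzero. [folklore] -/
theorem chiCube_eq_one_of_ne_zero {x : Tor (fine n M) × Fin (d + 1)} (hx : chiCube M n c₀ S x ≠ 0) : chiCube M n c₀ S x = 1 := by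
  unfold chiCube at hx ⊢
  by_cases h : blockOf n M x.1 ∈ cubeBlocks M c₀ S
  · rw [if_pos h]
  · rw [if_neg h] at hx; exact absurd rfl hx

/-- `M_{χ_□}∘M_{χ_□} = M_{χ_□}` (52's `hψχ` with `ψ := χ := χ_□`). [folklore] -/
theorem mulOp_chiCube_idem : mulOp (chiCube M n c₀ S) ∘ₗ mulOp (chiCube M n c₀ S) = mulOp (chiCube M n c₀ S) :=
  mulOp_comp_mulOp_of_support_left fun _ hx => chiCube_eq_one_of_ne_zero hx

/-- ★ **THE PLATEAU IDENTITY `G(□ + c)∘M_{χ_□} = G(□ + c)`** (52's `hNψ` with `ψ := χ_□`): the Neumann cube propagator only reads sources in the cube's blocks (dag-n15-a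
`neumannCubeG_eq_chiCube`: `G(□ + c) = Sym∘G∘M_{χ_□}`). [cite: Balaban1984PropagatorsII, (2.37) p.229] -/
theorem neumannCubeG_comp_mulOp_chiCube (hM : ∀ ν, M ν = 2 * S) {a : ℝ} (ha : 0 < a) :
    neumannCubeG M n c₀ S a ∘ₗ mulOp (chiCube M n c₀ S) = neumannCubeG M n c₀ S a := by
  have hn : 1 ≤ n := Nat.one_le_iff_ne_zero.mpr (NeZero.ne n)
  rw [neumannCubeG_eq_chiCube M n c₀ S a hM hn ha, LinearMap.comp_assoc, LinearMap.comp_assoc, mulOp_chiCube_idem]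

/-- ★ **THE EXACT LOCALITY OF THE FLAT CUBE ON THE PARTITION** (52's `hloc0`): `M_{h_k}∘((Σ_μ∇*_μ∇_μ + 0) + (aQ*Q − ∂Π∂*))∘G(□_k) = M_{h_k}` — dag-n15-a N-IIIa
`mulOp_comp_deltaOp_comp_neumannCubeG` on FILE 66's `supp h_k ⊂ intBonds(□_k)`, read through FILE 69's split of `Δ_a`; weight `c = n`, window `m₀ + 2w + 1 ≤ qw`.
[cite: Balaban1984PropagatorsII, (2.37)–(2.38) p.229, (2.91) p.239] -/
theorem mulOp_coverH_comp_lapOp_add_comp_neumannCubeG {w q m₀ : ℕ} (hM : ∀ ν, M ν = 2 * q * w) (hw : 0 < w) (hfit : m₀ + 2 * w + 1 ≤ q * w) {a : ℝ} (ha : 0 < a)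
    {c : ℝ} (hc : c = (n : ℝ)) (k : Fin (d + 1) → ZMod (2 * q)) :
    mulOp (hcube (2 * q) (coverXi M n w) k) ∘ₗ (lapOp c (bshiftEquiv M n) 0 + (a • (qvAdjRe M n ∘ₗ qvRe M n) + (-landauRe M n))) ∘ₗ
      neumannCubeG M n (coverCorner M w q m₀ k) (q * w) a = mulOp (hcube (2 * q) (coverXi M n w) k) := by
  subst hc
  have hM' : ∀ ν, M ν = 2 * (q * w) := fun ν => by rw [hM ν, mul_assoc]
  have hn : 1 ≤ n := Nat.one_le_iff_ne_zero.mpr (NeZero.ne n)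
  rw [← deltaOp_eq_lapOp_zero_add M n a]
  exact mulOp_comp_deltaOp_comp_neumannCubeG M n (coverCorner M w q m₀ k) (q * w) a hM' hn ha fun b hb => mem_intBonds_of_hcube_ne_zero hM hw hfit hb

end CubeRows

/-! ## §4 The tail row at the cover -/

section Tail

variable {M : Fin (d + 1) → ℕ} [∀ μ, NeZero (M μ)] {L kk n w q m₀ S : ℕ} [NeZero n]

omit [∀ μ, NeZero (M μ)] [NeZero n] in
/-- `|1 − χ̃_k| ≤ 1` for the sampled bump. [folklore] -/
theorem abs_one_sub_bcube_cover_le_one (R : ℝ) (k : Fin (d + 1) → ZMod (2 * q)) (x : Tor (fine n M) × Fin (d + 1)) :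
    |(1 - bcube (2 * q) (coverXi M n w) R k) x| ≤ 1 := by
  rw [Pi.sub_apply, Pi.one_apply, abs_le]
  have h0 := bcube_nonneg (2 * q) (coverXi M n w) R k x
  have h1 := bcube_le_one (2 * q) (coverXi M n w) R k x
  constructor <;> linarith

/-- ★★★ **THE TAIL ROW OF THE DRESSED SMOOTH-CUT CUBE AT THE COVER** (52's `hT` on the scalar carrier): on the doubled torus `M_ν = 2qw = 2S`, for the cube `□_k` of side `S`
(`m₀ + 2w + 1 ≤ S`), the partition `h_k`, the radius-2 bump `χ̃_k` and `q ≥ 2`: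
`(−M_{h_k}∘(aQ*Q − ∂Π∂*)∘M_{1−χ̃_k})∘G(□_k) ≤ 1_□(y)1_□(y′)·2^{d+1}(|a|e^{2δ_N} + C₁)e^{−(δ_N−ρ₁)w}·Ce^{δ₀}c_r·e^{−ρ|y−y′|_T}` — dag-n15-a N-IIt `hasMaj_tail_neumannCubeG` with `H` the blocks meeting
`supp h_k`, `A` the inner box (§2) and `gap = w`: EXPONENTIALLY SMALL IN THE RESOLUTION `w`.  Torus letters `G ≤ Ce^{−δ₀d}`, `∂Π∂* ≤ C₁e^{−δ₁d}` displayed.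
[cite: Balaban1984PropagatorsII, (2.92)–(2.93) p.239 (the `ζ_□` device), (2.133)–(2.134) p.247; Balaban1985BackgroundPropagators, (3.63)–(3.65) pp.402–403 (mechanism); Balaban1984PropagatorsI, Prop. 1.2 (1.110) p.35, (1.126) p.38] -/
theorem hasMaj_tail_cover (hM : ∀ ν, M ν = 2 * q * w) (hM2 : ∀ ν, M ν = 2 * S) (hw : 0 < w) (hq : 2 ≤ q) (hfit : m₀ + 2 * w + 1 ≤ S) (hS : S ≤ 2 * q * w)
    {a C δ₀ C₁ δ₁ δN ρ₁ ρ σ cr : ℝ} (htri : Triangle254 (unitTorusGeo L kk M)) (hrow : RowSum (unitTorusGeo L kk M) σ cr) (hC : 0 ≤ C) (hδ₀ : 0 ≤ δ₀) (hC₁ : 0 ≤ C₁)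
    (hδN : 0 ≤ δN) (hδN₁ : δN ≤ δ₁) (hρ₁ : ρ₁ ≤ δN) (hρ : 0 ≤ ρ) (hρδ : ρ ≤ δ₀) (hρσ : ρ + σ ≤ ρ₁)
    (hG : HasMaj (BlockNorm.ofBlocks (unitTorusGeo L kk M) (fun b : Tor (fine n M) × Fin (d + 1) => blockOf n M b.1))
      (BlockNorm.ofBlocks (unitTorusGeo L kk M) (fun b : Tor (fine n M) × Fin (d + 1) => blockOf n M b.1)) (gOp M n a) (fun y y' => C * Real.exp (-(δ₀ * tdistT M y y'))))
    (hNL : HasMaj (BlockNorm.ofBlocks (unitTorusGeo L kk M) (fun b : Tor (fine n M) × Fin (d + 1) => blockOf n M b.1))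
      (BlockNorm.ofBlocks (unitTorusGeo L kk M) (fun b : Tor (fine n M) × Fin (d + 1) => blockOf n M b.1)) (landauRe M n) (fun y y' => C₁ * Real.exp (-(δ₁ * tdistT M y y'))))
    (k : Fin (d + 1) → ZMod (2 * q)) :
    HasMaj (BlockNorm.ofBlocks (unitTorusGeo L kk M) (fun b : Tor (fine n M) × Fin (d + 1) => blockOf n M b.1))
      (BlockNorm.ofBlocks (unitTorusGeo L kk M) (fun b : Tor (fine n M) × Fin (d + 1) => blockOf n M b.1))
      ((-(mulOp (hcube (2 * q) (coverXi M n w) k) ∘ₗ (a • (qvAdjRe M n ∘ₗ qvRe M n) + (-landauRe M n)) ∘ₗ mulOp (1 - bcube (2 * q) (coverXi M n w) 2 k))) ∘ₗ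
        neumannCubeG M n (coverCorner M w q m₀ k) S a)
      (fun y y' => ind (cubeBlocks M (coverCorner M w q m₀ k) S : Set (Tor M)) y * ind (cubeBlocks M (coverCorner M w q m₀ k) S : Set (Tor M)) y' *
        (2 ^ (d + 1) * ((|a| * (Real.exp δN * Real.exp δN) + C₁) * Real.exp (-((δN - ρ₁) * w)) * (C * Real.exp δ₀) * cr) * Real.exp (-(ρ * tdistT M y y')))) :=
  hasMaj_tail_neumannCubeG (L := L) (k := kk) (c := coverCorner M w q m₀ k) (S := S) hM2 htri hrow hC hδ₀ hC₁ hδN hδN₁ hρ₁ hρ hρδ hρσ hG hNL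
    (H := {y : Tor M | ∃ x : Tor (fine n M) × Fin (d + 1), blockOf n M x.1 = y ∧ hcube (2 * q) (coverXi M n w) k x ≠ 0})
    (A := ((cubeBlocks M (coverCorner M w q (w - 1) k) (4 * w - 1) : Finset (Tor M)) : Set (Tor M)))
    (fun x => abs_coverH_le_one k x) (fun x hx => by by_contra h; exact hx ⟨x, rfl, h⟩)
    (fun y hy => by obtain ⟨x, hxy, hx⟩ := hy; rw [← hxy]; exact blockOf_mem_cubeBlocks_of_hcube_ne_zero_side hM hw hfit hS hx)
    (fun x => abs_one_sub_bcube_cover_le_one 2 k x)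
    (fun x hx => by rw [Pi.sub_apply, Pi.one_apply, bcube_cover_eq_one_of_mem_innerBox hM hw (Finset.mem_coe.mp hx), sub_self])
    (fun y y' hy hy' => by obtain ⟨x, hxy, hx⟩ := hy; rw [← hxy]; exact coverGap_le_tdistT hM hw hq hx (fun h => hy' (Finset.mem_coe.mpr h)))

end Tail

end Summit.QuantumFields.YangMills.BalabanUVNodes.N15.Gluing

end
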